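import Literature.Computability.QuantumComplexity.GRLevelConj
import Literature.Computability.QuantumComplexity.GroverRudolph
import HarnessLib

/-!
# The Grover–Rudolph block: all levels of one point register

Topic `Literature/Computability/QuantumComplexity`; sequel of `GRLevelConj.lean` (one level step
`C_rev · G · C` implementing the machine's level gate). For one point register `ws : Fin ℓ ↪ Fin N` of
Regev's sampler (Lemma 3.14 via Lemma 3.12: the Grover–Rudolph stage prepares the one-dimensional
discretised Gaussian level by level) the block runs the level steps `j = 0, …, ℓ−1`; by
`ImplOn.listProd` it implements the product of the machine's level gates
`genLevelGate ws R j`, `R j y = rotC (a j y)` (`GroverRudolph.genLevelGate`), on labels clean on the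
kit and on every level's work window, up to `ℓ · grErr k`:

* `GRBlock.Data` — the per-level data and hypotheses (machine `MachOK`, geometry `ConjGeom`, wires
  `WiresOK`, kit bounds `ProgOK`, the PARAMETER wires `pw` carrying a fixed content `c` — the instance
  parameters the cosine machine reads (they sit on wires, not in the circuit, for uniformity) — and the
  field specification `spec`: on labels whose parameter wires hold `c` the machine's word encodes the
  cosine `a j`); `GRBlock.dposP` (the machine's data positions: prefix, then parameters); `GRBlock.P` —
  the clean-input condition (kit clean, windows clean, parameters `= c`); `GRBlock.stepMat`, `steps`;
* **`GRBlock.prod_steps_implOn`** — `ImplOn P (Π_j stepMat j) ((ofFn (genLevelGate ws R)).reverse.prod) (ℓ · grErr k)`.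

Everything here is proved; definitions have bodies; no named fact is introduced. Combined with
`GaussianCells.l2Norm_prod_machineBlock_sub_qsample_le` (`a j y = machineA/2^k`) this bounds the distance
of the block's output from the one-dimensional Gaussian cell state.

## References

* O. Regev, J. ACM 56 (2009), art. 34, Lemma 3.12 (proof), Lemma 3.14 (proof) [Regev2009].
* L. Grover, T. Rudolph, arXiv:quant-ph/0208112 (2002), eq. (4)–(5) [GroverRudolph2002].
* M. A. Nielsen, I. L. Chuang, *Quantum Computation and Quantum Information*, CUP 2010, §4.5.3 [NielsenChuang2010].
-/

noncomputable section

namespace Literature.Computability.QuantumComplexity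

open Literature.Computability.Complexity (bitsToNat)
open _root_.Matrix Finset Cryptography RevSim GadgetKit GaussianCells GroverRudolph GRWord Complexity.FinTM2Sim Turing

namespace GRBlock

variable {N ℓ : ℕ}

/-- The prefix positions of a point register, as naturals. [folklore] -/
def dposOf (ws : Fin ℓ ↪ Fin N) (i : ℕ) : ℕ := if h : i < ℓ then (ws ⟨i, h⟩ : ℕ) else 0

/-- **The data positions of level `j`**: the prefix `ws 0 … ws (j−1)`, then the `np` parameter wires. [folklore] -/
def dposP {np : ℕ} (ws : Fin ℓ ↪ Fin N) (pw : Fin np ↪ Fin N) (j i : ℕ) : ℕ :=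
  if i < j then dposOf ws i else if h : i - j < np then (pw ⟨i - j, h⟩ : ℕ) else 0

/-- On the prefix. [folklore] -/
theorem dposP_of_lt {np : ℕ} (ws : Fin ℓ ↪ Fin N) (pw : Fin np ↪ Fin N) {j i : ℕ} (hi : i < j) : dposP ws pw j i = dposOf ws i := if_pos hi

/-- On the parameters. [folklore] -/
theorem dposP_param {np : ℕ} (ws : Fin ℓ ↪ Fin N) (pw : Fin np ↪ Fin N) (j : ℕ) (t : Fin np) : dposP ws pw j (j + t) = (pw t : ℕ) := by
  unfold dposP
  rw [if_neg (by omega), dif_pos (by simp)]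
  simp

/-- **The per-level data and hypotheses of a Grover–Rudolph block.** The cosine machine of level `j` reads
`j + np` data bits: the prefix of the point, then the parameter wires. [cite: Regev2009, Lemma 3.12 (proof)] -/
structure Data {np : ℕ} (kit : GadgetKit N) (ws : Fin ℓ ↪ Fin N) (pw : Fin np ↪ Fin N) (a : Fin ℓ → (Fin ℓ → Bool) → ℝ) where
  /-- time exponent of the cosine machine -/
  e : ℕ
  /-- the cosine machine -/
  M : TM2ComputableAux Bool Bool
  /-- the constant suffix of level `j` -/
  v : Fin ℓ → List Bool
  /-- the output word of level `j` on the data word -/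
  fbits : Fin ℓ → List Bool → List Bool
  /-- base of the work window -/
  base : ℕ
  /-- the content of the parameter wires -/
  c : Fin np → Bool
  /-- the kit is well formed -/
  hk : kit.OK
  /-- the machine hypothesis of every level, on data words whose parameter part is `c` -/
  hM : ∀ j : Fin ℓ, MachOK kit e M (j + np) (v j) (fun d => d.drop j = List.ofFn c) (fbits j)
  /-- the geometry of every level -/
  hG : ∀ j : Fin ℓ, ConjGeom kit (ws j) e M (j + np) (v j) (dposP ws pw j) base
  /-- the wires of every level -/
  hW : ∀ j : Fin ℓ, WiresOK kit (ws j) (fsEmb (hG j))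
  /-- the kit bounds -/
  hP : ProgOK kit
  /-- **the field specification**: with the parameters in place the machine's word encodes the cosine -/
  spec : ∀ (j : Fin ℓ) (z : QReg N), (∀ t, z (pw t) = c t) →
    SLP.aTil kit.k (bitsToNat (fbits j (dataOf (kit := kit) (j + np) (dposP ws pw j) z))) = a j (z ∘ ws)
  /-- the cosines lie in `[−1, 1]` and do not read level `j` or above -/
  a_abs : ∀ j y, |a j y| ≤ 1
  a_update : ∀ j y b, a j (Function.update y j b) = a j y
  /-- the point wires are off every work window and off the kit's clean wires -/
  ws_off : ∀ (i j : Fin ℓ), ws i ∉ workWires (kit := kit) e M (j + np) (v j) base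
  ws_kit : ∀ i : Fin ℓ, ws i ∉ kit.cr :: kit.as ++ kit.region ++ kit.hs
  /-- the parameter wires are not point wires -/
  pw_ws : ∀ (t : Fin np) (i : Fin ℓ), pw t ≠ ws i

/-- The blocks of the ideal level gates. [cite: GroverRudolph2002, eq. (4)] -/
def R (a : Fin ℓ → (Fin ℓ → Bool) → ℝ) (j : Fin ℓ) (y : Fin ℓ → Bool) : Matrix (QReg 1) (QReg 1) ℂ := rotC (a j y)

namespace Data

variable {np : ℕ} {kit : GadgetKit N} {ws : Fin ℓ ↪ Fin N} {pw : Fin np ↪ Fin N} {a : Fin ℓ → (Fin ℓ → Bool) → ℝ} (D : Data kit ws pw a)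

/-- **The parameter condition**: the parameter wires hold `c`. [folklore] -/
def C : Set (QReg N) := {z | ∀ t, z (pw t) = D.c t}

/-- **The clean-input condition of the block**: the kit's condition, every level's work window clean, the
parameters in place. [folklore] -/
def P : Set (QReg N) := (kit.P ∩ ⋂ j : Fin ℓ, cleanOn (workWires (kit := kit) D.e D.M (j + np) (D.v j) D.base)) ∩ D.C

/-- **The matrix of level step `j`**: uncompute · rotate · compute. [cite: Regev2009, Lemma 3.12 (proof)] -/
def stepMat (j : Fin ℓ) : Matrix (QReg N) (QReg N) ℂ :=
  (CleanPlaced.circuitRev (D.hG j).geom (hN := kit.hN)).toMatrix 0 * (grWord D.hk (D.hW j) D.hP).toMatrix 0 *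
    (CleanPlaced.circuit (D.hG j).geom (hN := kit.hN)).toMatrix 0

/-- The step of level `j`. [folklore] -/
def step (j : Fin ℓ) : ApproxStep N := ⟨D.stepMat j, genLevelGate ws (R a) j, grErr kit.k⟩

/-- **The steps of the block** (last level first in the list = applied last). [folklore] -/
def steps : List (ApproxStep N) := (List.ofFn D.step).reverse

/-- The parameter condition ignores the point wires. [folklore] -/
theorem update_mem_C_iff (i : Fin ℓ) (x : QReg N) (b : Bool) : Function.update x (ws i) b ∈ D.C ↔ x ∈ D.C := by
  unfold C
  simp only [Set.mem_setOf_eq]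
  refine forall_congr' fun t => ?_
  rw [Function.update_of_ne (D.pw_ws t i)]

/-- The condition ignores the point wires. [folklore] -/
theorem update_mem_P_iff (i : Fin ℓ) (x : QReg N) (b : Bool) : Function.update x (ws i) b ∈ D.P ↔ x ∈ D.P := by
  have h1 := D.ws_kit i
  rw [List.mem_append, not_or] at h1
  unfold P GadgetKit.P
  simp only [Set.mem_inter_iff, Set.mem_iInter]
  rw [update_mem_cleanOn_iff h1.1, update_mem_cleanOn_iff h1.2, update_mem_C_iff]
  refine and_congr (and_congr Iff.rfl (forall_congr' fun j => ?_)) Iff.rfl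
  rw [update_mem_cleanOn_iff (D.ws_off i j)]

/-- **Every step is good on the block's condition.** [cite: Regev2009, Lemma 3.12 (proof)] -/
theorem step_good (j : Fin ℓ) : (D.step j).Good D.P := by
  have hsub : D.P ⊆ kit.P ∩ cleanOn (workWires (kit := kit) D.e D.M (j + np) (D.v j) D.base) := fun x hx =>
    ⟨hx.1.1, Set.mem_iInter.1 hx.1.2 j⟩
  have hD : ∀ z ∈ D.P, (dataOf (kit := kit) (j + np) (dposP ws pw j) z).drop j = List.ofFn D.c := by
    intro z hz
    unfold dataOf
    apply List.ext_getElem (by simp)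
    intro i h₁ h₂
    rw [List.getElem_drop, List.getElem_ofFn, List.getElem_ofFn]
    simp only
    have ht : i < np := by simpa using h₂
    have := dposP_param ws pw j ⟨i, ht⟩
    simp only at this
    rw [this, show finOf N kit.hN (pw ⟨i, ht⟩ : ℕ) = pw ⟨i, ht⟩ from Fin.ext (val_finOf_of_lt kit.hN (pw ⟨i, ht⟩).2)]
    exact hz.2 ⟨i, ht⟩
  have himpl := levelStep_implOn D.hk (D.hM j) (D.hG j) (D.hW j) D.hP hsub hD (U := fun z => rotC (a j (z ∘ ws)))
    fun z hz => by rw [D.spec j z hz.2]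
  have hideal : genLevelGate ws (R a) j = ctrlGate (ws j) fun z => rotC (a j (z ∘ ws)) := rfl
  have hRu : ∀ j y, R a j y ∈ Matrix.unitaryGroup (QReg 1) ℂ := fun j y => SLP.rotC_mem_unitaryGroup' (D.a_abs j y)
  have hRind : ∀ j y b, R a j (Function.update y j b) = R a j y := fun j y b => by unfold R; rw [D.a_update]
  exact
    { implOn := by
        show ImplOn D.P (D.stepMat j) (genLevelGate ws (R a) j) (grErr kit.k)
        rw [hideal]; exact himpl
      act_contr := by
        show IsContraction (D.stepMat j)
        unfold stepMat
        exact ((isContraction_of_mem_unitaryGroup (CleanPlaced.circuit_mem_unitaryGroup (D.hG j).geom).2).mul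
          (grWord_good D.hk (D.hW j) D.hP).act_contr).mul (isContraction_of_mem_unitaryGroup (CleanPlaced.circuit_mem_unitaryGroup (D.hG j).geom).1)
      ideal_contr := isContraction_of_mem_unitaryGroup (genLevelGate_mem_unitaryGroup ws (R a) hRu hRind j)
      ideal_pres := GroverRudolph.preservesSupp_ctrlGate (fun x b => D.update_mem_P_iff j x b) _
      err_nonneg := by show (0 : ℝ) ≤ grErr kit.k; unfold grErr; positivity }

/-- **The Grover–Rudolph block implements the product of the machine's level gates** on its condition up
to `ℓ · grErr k`. [cite: Regev2009, Lemma 3.12 (proof)] [cite: GroverRudolph2002, eq. (4)–(5)] -/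
theorem prod_steps_implOn :
    ImplOn D.P ((D.steps.map ApproxStep.act).prod) ((List.ofFn fun j => genLevelGate ws (R a) j).reverse.prod) (ℓ * grErr kit.k) := by
  have hgood : ∀ s ∈ D.steps, s.Good D.P := by
    intro s hs
    rw [steps, List.mem_reverse, List.mem_ofFn] at hs
    obtain ⟨j, rfl⟩ := hs
    exact D.step_good j
  have h := ImplOn.listProd hgood
  have hideal : D.steps.map ApproxStep.ideal = (List.ofFn fun j => genLevelGate ws (R a) j).reverse := by
    rw [steps, List.map_reverse, List.map_ofFn]; rfl
  have herr : (D.steps.map ApproxStep.err).sum = ℓ * grErr kit.k := by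
    rw [steps, List.map_reverse, List.sum_reverse, List.map_ofFn, List.sum_ofFn]
    simp only [Function.comp_apply, step, sum_const, card_univ, Fintype.card_fin, nsmul_eq_mul]
  rw [hideal, herr] at h
  exact h

/-- The actual matrices of the steps multiply to the block's matrix (by definition). [folklore] -/
theorem steps_map_act : D.steps.map ApproxStep.act = (List.ofFn D.stepMat).reverse := by
  rw [steps, List.map_reverse, List.map_ofFn]; rfl

end Data

end GRBlock

end Literature.Computability.QuantumComplexity

end
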